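import Summits.BirchSwinnertonDyer.Rank1Residual.F1Sign2.SquareLawAtTwo
import Summits.BirchSwinnertonDyer.Rank1Residual.F1Sign2.AnalyticLineTransferAtTwo
import Mathlib.NumberTheory.NumberField.Basic
import HarnessLib

/-!
# Cell `bsd-f1-sign2` — Euler-system lens (seat `-es`, g4; MEMO-es §13): the 2-adic KUMMER ENTANGLEMENT class — what is special
about the Kolyvagin/Kummer-prime selection at `p = 2`

STATEMENTS + three DEFINITIONS WITH BODY + PROVED glue (predicates `HasFullFourTorsionOver`, `TwoDivisibleOver`, `KummerEntangledAtTwo`;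
seven `@[conjecture] def`s exactly as the planner's sketch has them — KENT `EntangledKummerPrimeLawAtTwo`, KENT′ `EntangledKummerTraceLawAtTwo`,
ENT-EXPLICIT `EntangledExplicitCriterionAtTwo`, CHEB1 `LevelPrimesExistAtTwo`, CHEB2 `DisentangledKummerPrimeAtTwo`, ENT-FLAT
`FlatFirstLayerOfEntangledAtTwo`, NEGDISC `EntangledNegativeDiscriminantAtTwo`; four glue theorems PROVED — `entangledKummerPrimeLaw_of_traceLaw`
(KENT′ ⇒ KENT), `kummerPrimeAtTwo_of_dichotomy` (KENT → CHEB1 → CHEB2 → the tree support `KummerPrimeAtTwo` of `SquareLawAtTwo.lean`),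
`flatFirstLayer_of_squareLaw` (K2-F♯ `SquareLawAtTwo` → KENT → ENT-FLAT), `exact_valuation_of_entangled`; nothing asserted, no named fact, no `sorry`).

TYPER FILING (seat `bsd-f1-sign2-ty` g3; CANDIDATES.md rows ES-ENT / ES-ENT-EXPLICIT / ES-KENT′ / ES-KENT / ES-CHEB1 / ES-CHEB2 / ES-KUM2 / ES-ENT-FLAT /
ES-NEGDISC): bodies VERBATIM from the planner's `HOME/data-es/g4/SketchG9.lean` a2ef58aa12b1e273 (-es g4 2026-08-28T00:30:46Z «CANDIDATES-delta», suggested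
landing file = this one; MEMO-es.md ac69a897fb3fa149 §13.6; `lean check` rc 0 / 0 warn / 0 sorry per -es and re-checked by the typer against the tree; BC5
witness DES13-ENT kit j294757 / j294743 / j294925, archive `HOME/data-es/des13/` + SHA16.txt, ENGINE C on DES10 ∪ DES11); the only edits are this header,
one extra `import` (`F1Sign2/AnalyticLineTransferAtTwo`) and ONE dedup substitution: the sketch's local `def twoDivisionCubic W := X³ + b₂X² + 8b₄X + 16b₆`
is the TREE's `twoDivisionUCubic W` (`F1Sign2/AnalyticLineTransferAtTwo.lean` :67, byte-identical polynomial), so the local def is dropped and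
`EntangledExplicitCriterionAtTwo` is typed over `twoDivisionUCubic` (two occurrences; neutral cut, search-first rule — the planner's side note on `h_W`
is kept in that docstring). REF1-AUDIT-v1 §50 (audit file 65e12a8776b330d2 / 1290 l., 2026-08-28T00:39:28Z; evidence `HOME/REF1-data/b47/` + SHA16.txt; D-es-ref1 A1–A6 of 2026-08-28T00:30:46Z ANSWERED): SketchG9 a2ef58aa12b1e273 as-is rc 0 (0 sorry); **7/7 SURVIVE** — the load-bearing group cohomology RE-COMPUTED independently (`h1gl2z4.py`: `H¹(GL₂(ℤ/4), E[2]) = 𝔽₂`; KENT′ trace law on the 48 lifts: `ξ(g) ∉ (ḡ − 1)E[2] ⟺ tr g ≡ 2 (mod 4)`; NEGDISC: `ξ(c)` = the third line for all 6 `Δ > 0` complex-conjugation classes `1 + 2A`, `A` rank 1 trace 1, vs `κ_∞(E(ℝ)/2) = {0, im A}`) ⇒ **KENT′, KENT, NEGDISC THEOREM-grade**; ENT-EXPLICIT folklore theorem-grade (`ξ_E = [−Δ h′(θ)]` re-derived); CHEB1 in-print assembly; CHEB2 in-print assembly given JR10 Thm 5.2; ENT-FLAT = K2-F♯|entangled +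 KENT (glue kernel-checked); `kummerPrimeAtTwo_of_dichotomy` ⇒ the tree support `KummerPrimeAtTwo` is theorem-grade-in-print. (The planner's own finite core is also kernel-checked seat-side: `data-es/g4/KENTCore.lean` bcc98c17d69fe6b7 — explicit 1-cocycle `z : GL₂(ℤ/4) → 𝔽₂²`, cocycle / non-coboundary / trace law by `native_decide` and `decide`; evidence #11 on stmt-23715; not filed here — `native_decide` is outside the gate's axiom whitelist.)
REF2-PLACEMENT v16 §38 (a6d2539e2f1eb2e2, 2026-08-28T00:34:56Z; D-es-ref2 ANSWERED): **(a) the object `ξ_E` / the dichotomy = KNOWN — CONFIRMED**: Jones–Rouse 2010 Thm 5.2 `ℓ = 2` clause [`paper:arxiv-0706.2384` p0015 L11–20], Prop 5.1 [p0014 L24, L113–126], Remark [p0015 L57–60] (its entangled example `y² + y = x³ − 3x + 4` has `Δ = −6075 < 0`, and 37a1 (`Δ = 37`) is not entangled — both CONSISTENT with NEGDISC) [cite: JonesRouse2010, Thm. 5.2, Prop. 5.1]; BGGHKPR 2016 / Cerchia–Rouse / Lombardo–Tronto as the planner cites; Lawson–Wuthrich Thm 1 = the planner's «`0` at `k = 1`»,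 §7.1 level-2 numerics [arXiv:1505.02940 p0002, p0014] [cite: LawsonWuthrich2016, Thm. 1]; SIBLING line to cite (same cohomology): local–global divisibility by 4 (Dvornicich–Zannier 2001/2004, Paladino 2010–11, Creutz arXiv:1206.2420, Çiperiani–Stix 2015, Lawson–Wuthrich Thm 24 [p0015]). **(b) `α_E = −Δ·h′(θ)`, `F_E`**: not found verbatim; in-print assembly (halving formulas `x(½T_i) = θ_i ± √((θ_i − θ_j)(θ_i − θ_k))` ⇒ `√h′(θ_i) ∈ ℚ(E[4])`; `√−1`, `√Δ` there too) + a two-line identification — new as a sentence only. **(c) KENT′ / KENT / KUM2**: not in print as sentences; in-print assembly, corollary-grade inside JR10 §5 / BGGHKPR's Frobenius-statistics framework (48-element enumeration, decidable). **(d) NEGDISC**: NOT FOUND; elementary, theorem-grade, new sentence, consistent with both printed examples. **(e) ENT-FLAT**: conditional corollary of the unprinted K2-F♯. **(f) «dichotomy used in a Kolyvagin argument at 2» NOT FOUND — CONFIRMED, gap locus pinned**: Gross 1991 Prop 9.1 / McCallum 1991 §3 [book-editornd p0279 L17–21, `p` odd, injectivity into `H¹(K(E_{p^M}))`], LW §5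 Thm 14 (`p` odd), Kolyvagin 1990 Thm A / Cor 11–13 whose error term `d` is a 2-power («`d = 1` since `p ≠ 2`», Matar–Nekovář JTNB 2019 p. 456 [doi-10-5802-jtnb-1091 p0002 L19–22]) — Kolyvagin absorbs 2 into `d`; Kolyvagin 1990 itself CITE-ONLY. GRADE AGREED: object KNOWN; laws §13.2–13.4 NEW-COMBINATION, not in print as sentences; beyond-print theorem: no as booked (KENT′ / NEGDISC theorem-grade corollary-size).
PARTITION: none moved; beyond-print theorem: no (the planner: statements; KENT / KENT′ / NEGDISC theorem-grade by finite group cohomology + Hensel /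
the real place, CHEB1 / CHEB2 in-print assembly, ENT-FLAT conjecture ⟸ K2-F♯ + KENT).
bears_on: `stmt-BirchSwinnertonDyer-19099` `RankOneAtTwo` → child 23715 `RankOneAtTwoBigImageOddLocal` (line fkl: `KummerPrimeAtTwo` is the input of
K2-F (b); idea card `Cruxes/RankOneAtTwoBigImageOddLocal/Ideas/kummer-entanglement-class-at-two.md`).

Planner's module docstring (verbatim):

# Sketch G9 (cell bsd-f1-sign2, seat -es g4): the 2-adic KUMMER ENTANGLEMENT class — what is special
about the Kolyvagin/Kummer-prime selection at `p = 2`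

Seat-local sketch (HOME `data-es/g4/`), statements over tree declarations + three kernel-checked logic
lemmas, 0 sorry; nothing asserted.  Imports landing part 5 (`SquareLawAtTwo`, tree).

THE OBJECT.  For `E/ℚ` with `ρ_{E,4}` onto `GL₂(ℤ/4)`:  `H¹(Gal(ℚ(E[2^k])/ℚ), E[2]) = 𝔽₂ · ξ_E` for every
`k ≥ 2` (`= 0` for `k = 1`); the class `ξ_E` is inflated from `ℚ(E[4])` and, in the Schaefer–Stoll
model `H¹(ℚ, E[2]) = ker(N : L^×/L^{×2} → ℚ^×/ℚ^{×2})`, `L = ℚ[u]/(h)`, `h(u) = u³ + b₂u² + 8b₄u + 16b₆`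
(`w² = h(u)`, `u = 4x`), it is the class of `α_E := −Δ_E · h'(θ)`.  It is killed exactly by the canonical
`S₄`-field `F_E = ℚ(E[2])(√−h'(θ₁), √−h'(θ₂), √−h'(θ₃)) ⊂ ℚ(E[4])` (index-4 subgroup of `GL₂(ℤ/4)`).
For `P ∈ E(ℚ) ∖ 2E(ℚ)` the Kummer fibre `½P` is an `E[2]`-torsor with class `κ(P)`, and

  ENTANGLED(E, P)  :⟺  κ(P) = ξ_E  ⟺  ½P ⊂ E(ℚ(E[4]))  ⟺  ℚ(½P) ⊆ ℚ(E[2^k]) for some / every k ≥ 2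
                   ⟺  (u(P) − θ) · (−Δ_E) · h'(θ) ∈ L^{×2}            (`KummerEntangledAtTwo` below).

IN PRINT: the dichotomy is the `ℓ = 2` hypothesis «`F(β₁) ⊄ F(A[4])`» of Jones–Rouse, Proc. LMS 100 (2010)
Thm 5.2 (arboreal image `ℤ₂² ⋊ GL₂(ℤ₂)` iff not entangled; Remark: `y² + y = x³ − 3x + 4`, `α = (4,7)` IS
entangled) [corpus: paper:arxiv-0706.2384 p15]; Block Gorman–Genao–Hwang–Kantor–Parsons–Rouse, Acta Arith. 175
(2016) (entangled ⟹ arboreal index 4, odd-order density 179/336 vs 11/21) [corpus: paper:arxiv-1909.07468 p3];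
Lombardo–Tronto «ℓ-adic failure» `A₂(4) ≥ 4` [galaxy: pdf:1196786020 p13, p23–27 = Tronto, thesis Leiden 2022].
NOT FOUND IN PRINT (queries in MEMO-es §13.6): its role in the Kato–Kolyvagin prime selection at 2 and the
first-layer consequences below.

CONSEQUENCES TYPED HERE.
* KENT `EntangledKummerPrimeLawAtTwo` (THEOREM-grade; group cohomology of `GL₂(ℤ/2^k)` + Hensel, no
  Chebotarev): entangled ⟹ `P ∉ 2E(ℚ_ℓ)` at EVERY `τ`-prime `ℓ` of level `k ≥ 2` (every element of the
  `τ`-class `{g : ḡ transposition, det g ≡ 1, tr g ≡ 2 (mod 4)}` acts WITHOUT fixed point on the `ξ_E`-torsor: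
  brute force 12/12 at `k = 2`, 48/48 at `k = 3`, inflation for `k ≥ 3`).
* CHEB1 `LevelPrimesExistAtTwo`, CHEB2 `DisentangledKummerPrimeAtTwo` (Chebotarev; CHEB2 = Jones–Rouse
  Thm 5.2 + Chebotarev, IN-PRINT-ASSEMBLY) and the kernel-checked DICHOTOMY PROOF of the tree support
  `kummerPrimeAtTwo_of_dichotomy : KENT → CHEB1 → CHEB2 → KummerPrimeAtTwo`.
* ENT-FLAT `FlatFirstLayerOfEntangledAtTwo` + `flatFirstLayer_of_squareLaw : SquareLawAtTwo → KENT → ENT-FLAT`: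
  on entangled curves the first Kolyvagin layer at 2 is FLAT — `v₂ δ'_k(ℓ;ψ) = min(k, s+1)` at every
  `τ`-prime of level `≥ 2` (no `d`-spread), i.e. every deep `τ`-prime computes `#Ш[2^∞]` exactly.
* NEGDISC `EntangledNegativeDiscriminantAtTwo` (THEOREM-grade, real place): entangled ⟹ `Δ_E < 0`
  (`loc_∞ ξ_E = (−,+,−) ∉ κ_∞(E(ℝ)) = {(+,+,+),(+,−,−)}` when `Δ_E > 0`).
DATA (BC5 witness; kit tag bsd-frontier-data; archive HOME `data-es/des13/`, SHA16.txt): DES13-ENT j294757 (the 510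
DES10 ∪ DES11 non-CM rank-1 curves; ENGINE A = PARI `nfroots` in `L` (exact), ENGINE B = Chebotarev halving at the primes
`ℓ < 3·10⁴` split in `ℚ(E[4])`; A = B on 510/510; ENTANGLED = {190512l1 (s = 0, T = 1, Tam = 3, Δ < 0), 363609v1
(s = 4, Tam = 2, Δ < 0)} = exactly the ENGINE-C set of curves whose DES `τ`-rows obey `d = 0 ⟺ a_ℓ ≡ 2 (mod 4)`
(39/39, 38/38; the other 504 curves: agreement 0.503 ± 0.072); disentangled split-prime pass rate 3 987/17 088 = 0.233
(limit 1/4); level-≥2 rows: entangled 45/45 `d = 0`, disentangled 0.518), smoke j294743 (6/6), controls j294925 (the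
printed Jones–Rouse pair reproduces: `y²+y=x³−3x+4`, (4,7) entangled, B 23/23, Δ < 0; 37a1, (0,0) not, B 2/18, Δ > 0,
signs(α_E) = (−,+,−)).  See MEMO-es §13.
-/

noncomputable section

open scoped Classical MatrixGroups ModularForm

open CongruenceSubgroup WeierstrassCurve Literature.NumberTheory.EllipticCurves
  Literature.NumberTheory.EllipticCurves.ModularForms

namespace Summit.BirchSwinnertonDyer.Rank1Residual.F1Sign2

section Entanglement

/-- `E[4] ⊆ E(K)`: all sixteen `4`-torsion points of `E` are rational over the number field `K`
(i.e. `K ⊇ ℚ(E[4])` up to embedding). A predicate. [folklore] -/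
def HasFullFourTorsionOver (W : WeierstrassCurve ℚ) (K : Type) [Field K] [NumberField K] : Prop :=
  Nat.card {Q : (W.toAffine.baseChange K).Point // 4 • Q = 0} = 16

/-- `P ∈ 2 · E(K)` for a rational point `P` and a number field `K`. A predicate. [folklore] -/
def TwoDivisibleOver (W : WeierstrassCurve ℚ) (K : Type) [Field K] [NumberField K]
    (P : (W.toAffine.baseChange ℚ).Point) : Prop :=
  ∃ Q : (W.toAffine.baseChange K).Point,
    2 • Q = WeierstrassCurve.Affine.Point.baseChange (W' := W.toAffine) ℚ K P

/-- **ENT — 2-adic Kummer entanglement of `P`:** the halves of `P` are defined over (every number field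
containing) `ℚ(E[4])`; for `ρ_{E,4}` onto and `P ∉ 2E(ℚ)` this says `κ(P) = ξ_E`, the generator of
`H¹(Gal(ℚ(E[4])/ℚ), E[2]) = 𝔽₂`, equivalently `(u(P) − θ)·(−Δ_E)·h'(θ)` is a square in `ℚ(θ)`,
`θ` a root of the `2`-division cubic `h`.  (= failure of the `ℓ = 2` hypothesis of Jones–Rouse 2010 Thm 5.2.)
A predicate (definition with a body). [folklore] -/
def KummerEntangledAtTwo (W : WeierstrassCurve ℚ) (P : (W.toAffine.baseChange ℚ).Point) : Prop :=
  ∀ (K : Type) [Field K] [NumberField K], HasFullFourTorsionOver W K → TwoDivisibleOver W K P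

/-- **KENT (candidate support, THEOREM-grade; conjecture NEW as a statement, proof = group cohomology of
`GL₂(ℤ/2^k)` acting on `E[2]` + Hensel):** if `ρ_{E,2^∞}` is onto and `P ∈ E(ℚ)` is non-torsion, not in
`2E(ℚ)` and ENTANGLED, then at every `τ`-prime `ℓ` of level `k ≥ 2` (`ℓ ∤ 2N`, `Frob_ℓ` a transposition on
`E[2]`, `2^k ∣ ℓ − 1`, `2^k ∣ a_ℓ − 2`) the point `P` is NOT `2`-divisible in `E(ℚ_ℓ)`: EVERY such prime is a
Kummer prime (deterministic — no Chebotarev).  Mechanism: `Frob_ℓ ↦ g` in the `τ`-class of `GL₂(ℤ/4)`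
(`det ≡ 1`, `tr ≡ 2 (mod 4)`), and `ξ_E(g) ∉ (ḡ − 1)E[2]` for all twelve such `g`, so `g` fixes no half of `P`.
Why it might fail: only through a slip in the identification `H¹(GL₂(ℤ/2^k), E[2]) = 𝔽₂` (k ≥ 2) — checked by
brute force for `k = 2, 3` (seat file `ent/h1check.py`) and by Jones–Rouse's index-4 argument for all `k`.
Cheapest falsifier: ONE DES13-ENT entangled curve with a level-`≥ 2` row `d ≥ 1` (observed: 0 of 45 + 0 in controls).
[cite: JonesRouse2010, Thm. 5.2] -/
@[conjecture] def EntangledKummerPrimeLawAtTwo : Prop :=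
  ∀ (W : WeierstrassCurve ℚ) [W.IsElliptic] [W.IsGloballyMinimal],
    (∀ n : ℕ, W.HasSurjectiveModNGaloisRep ((2 ^ n : ℕ) : ℤ)) →
    ∀ P : (W.toAffine.baseChange ℚ).Point, (∀ n : ℕ, n ≠ 0 → n • P ≠ 0) →
      (∀ Q : (W.toAffine.baseChange ℚ).Point, 2 • Q ≠ P) → KummerEntangledAtTwo W P →
    ∀ (ℓ k : ℕ) [Fact ℓ.Prime], IsLevelAtTwo W ℓ → 2 ≤ k → (2 ^ k : ℤ) ∣ (ℓ : ℤ) - 1 →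
      (2 ^ k : ℤ) ∣ W.frobeniusTrace ℓ - 2 → ¬ LocallyTwoPowDivisible W ℓ 1 P

/-- **KENT′ — the TRACE LAW (candidate support, THEOREM-grade; sharpens KENT to ALL `τ`-primes):** for
`ρ_{E,2^∞}` onto and `P` non-torsion, `∉ 2E(ℚ)`, ENTANGLED: at every `τ`-prime `ℓ` (`IsLevelAtTwo W ℓ`:
`ℓ ∤ 2N`, `#Ẽ(𝔽_ℓ)[2] = 2`) the point `P` is `2`-divisible in `E(ℚ_ℓ)` iff `a_ℓ ≡ 0 (mod 4)` — the Kummer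
condition is READ OFF `a_ℓ mod 4`.  Mechanism: among the 48 lifts `g ∈ GL₂(ℤ/4)` of a transposition,
`ξ_E(g) ∉ (ḡ − 1)E[2]` iff `tr g ≡ 2 (mod 4)` (24/24 vs 24/24, independent of `det g`; seat file
`ent/h1level1.py`).  For NON-entangled `P` the Kummer condition is instead equidistributed (density `1/2`)
independently of `a_ℓ mod 4` (image `E[2] ⋊ GL₂`).  BC5 witness (ENGINE C, data only): the two entangled
DES curves obey the law on 39/39 and 38/38 `τ`-rows (all levels); the other 504 curves with `≥ 10` rows agree
with it on a fraction `0.503 ± 0.072` of their rows (max `0.732`; pooled `P(d=0 | a≡2) = 0.518`,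
`P(d=0 | a≡0) = 0.535`).  Why it might fail: as KENT.  Cheapest falsifier: one `τ`-row of an entangled curve
with `(d = 0) ≠ (a_ℓ ≡ 2 mod 4)`. [conjecture] -/
@[conjecture] def EntangledKummerTraceLawAtTwo : Prop :=
  ∀ (W : WeierstrassCurve ℚ) [W.IsElliptic] [W.IsGloballyMinimal],
    (∀ n : ℕ, W.HasSurjectiveModNGaloisRep ((2 ^ n : ℕ) : ℤ)) →
    ∀ P : (W.toAffine.baseChange ℚ).Point, (∀ n : ℕ, n ≠ 0 → n • P ≠ 0) →
      (∀ Q : (W.toAffine.baseChange ℚ).Point, 2 • Q ≠ P) → KummerEntangledAtTwo W P →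
    ∀ (ℓ : ℕ) [Fact ℓ.Prime], IsLevelAtTwo W ℓ →
      (LocallyTwoPowDivisible W ℓ 1 P ↔ ¬ (4 : ℤ) ∣ W.frobeniusTrace ℓ - 2)

/-- KENT′ ⟹ KENT (kernel-checked): at level `k ≥ 2`, `2^k ∣ a_ℓ − 2` gives `4 ∣ a_ℓ − 2`. -/
theorem entangledKummerPrimeLaw_of_traceLaw (h : EntangledKummerTraceLawAtTwo) :
    EntangledKummerPrimeLawAtTwo := by
  intro W _ _ hsurj P hP1 hP2 hent ℓ k _ hlev hk2 hl ha hdiv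
  have h4 : (4 : ℤ) ∣ W.frobeniusTrace ℓ - 2 := by
    have h22 : (2 : ℤ) ^ 2 ∣ (2 : ℤ) ^ k := pow_dvd_pow 2 hk2
    exact dvd_trans (by simpa using h22) ha
  exact ((h W hsurj P hP1 hP2 hent ℓ hlev).1 hdiv) h4

/-- **ENT-EXPLICIT (support, folklore computation = ENGINE A of DES13):** for `ρ_{E,4}` onto and an affine
non-torsion point `P = (x, y) ∉ 2E(ℚ)`:  `P` is entangled iff `(4x − θ)·(−Δ_W)·h_W'(θ)` is a square in
`L = ℚ[u]/(h_W) ∋ θ`.  (`κ(P) = 4x − θ` in `ker N ⊂ L^×/L^{×2}` [Cassels / Schaefer–Stoll]; `ξ_E = −Δ_W·h_W'(θ)`,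
the unique non-trivial class of `ker N` dying in `ℚ(E[4])`.)  Typed over the TREE's `u`-cubic `twoDivisionUCubic W = X³ + b₂X² + 8b₄X + 16b₆`
(`F1Sign2/AnalyticLineTransferAtTwo.lean`; the planner's sketch re-declared the byte-identical polynomial as `twoDivisionCubic` with the note
«`w² = h_W(u)` with `w = 4(2y + a₁x + a₃)`; `disc h_W = 2⁸Δ_W`; `N_{L/ℚ} h_W'(θ) = −2⁸Δ_W`» — dropped here for dedup, -ty g3).  [folklore] -/
@[conjecture] def EntangledExplicitCriterionAtTwo : Prop :=
  ∀ (W : WeierstrassCurve ℚ) [W.IsElliptic], W.HasSurjectiveModNGaloisRep 4 →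
    ∀ (x y : ℚ) (hP : (W.toAffine.baseChange ℚ).Nonsingular x y),
      (∀ n : ℕ, n ≠ 0 → n • (WeierstrassCurve.Affine.Point.some x y hP) ≠ 0) →
      (∀ Q : (W.toAffine.baseChange ℚ).Point, 2 • Q ≠ .some x y hP) →
      (KummerEntangledAtTwo W (.some x y hP) ↔
        IsSquare (AdjoinRoot.mk (twoDivisionUCubic W)
          ((Polynomial.C (4 * x) - Polynomial.X) * Polynomial.C (-W.Δ) *
            Polynomial.derivative (twoDivisionUCubic W))))

/-- **CHEB1 (support, IN-PRINT-ASSEMBLY: Chebotarev in `ℚ(E[2^k])` + cyclicity of `(ℤ/ℓ)ˣ`):** for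
`ρ_{E,2^∞}` onto there are `τ`-primes of every level `k ≥ 2`, with a surjective `ψ : (ℤ/ℓ)ˣ ↠ ℤ/2^k`.
[folklore] -/
@[conjecture] def LevelPrimesExistAtTwo : Prop :=
  ∀ (W : WeierstrassCurve ℚ) [W.IsElliptic] [W.IsGloballyMinimal],
    (∀ n : ℕ, W.HasSurjectiveModNGaloisRep ((2 ^ n : ℕ) : ℤ)) →
    ∀ K : ℕ, ∃ (ℓ k : ℕ) (_ : Fact ℓ.Prime) (ψ : (ZMod ℓ)ˣ →* Multiplicative (ZMod (2 ^ k))),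
      IsLevelAtTwo W ℓ ∧ K ≤ k ∧ 2 ≤ k ∧ (2 ^ k : ℤ) ∣ (ℓ : ℤ) - 1 ∧ (2 ^ k : ℤ) ∣ W.frobeniusTrace ℓ - 2 ∧
      Function.Surjective ψ

/-- **CHEB2 (support, IN-PRINT-ASSEMBLY = Jones–Rouse 2010 Thm 5.2 + Chebotarev):** if `P` is NOT
entangled, the arboreal image is `ℤ₂² ⋊ GL₂(ℤ₂)`, so `Gal(ℚ(E[2^k], ½P)/ℚ(E[2^k])) = E[2]` and Kummer
`τ`-primes (Frobenius moving every half of `P`) exist at every level (relative density `1/2`).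
[cite: JonesRouse2010, Thm. 5.2] -/
@[conjecture] def DisentangledKummerPrimeAtTwo : Prop :=
  ∀ (W : WeierstrassCurve ℚ) [W.IsElliptic] [W.IsGloballyMinimal],
    (∀ n : ℕ, W.HasSurjectiveModNGaloisRep ((2 ^ n : ℕ) : ℤ)) →
    ∀ P : (W.toAffine.baseChange ℚ).Point, (∀ n : ℕ, n ≠ 0 → n • P ≠ 0) →
      (∀ Q : (W.toAffine.baseChange ℚ).Point, 2 • Q ≠ P) → ¬ KummerEntangledAtTwo W P →
    ∀ K : ℕ, ∃ (ℓ k : ℕ) (_ : Fact ℓ.Prime) (ψ : (ZMod ℓ)ˣ →* Multiplicative (ZMod (2 ^ k))),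
      IsLevelAtTwo W ℓ ∧ K ≤ k ∧ 1 ≤ k ∧ (2 ^ k : ℤ) ∣ (ℓ : ℤ) - 1 ∧ (2 ^ k : ℤ) ∣ W.frobeniusTrace ℓ - 2 ∧
      Function.Surjective ψ ∧ ¬ LocallyTwoPowDivisible W ℓ 1 P

/-- **KUM2 — the tree support `KummerPrimeAtTwo` by DICHOTOMY (kernel-checked):** entangled ⟹ any deep
`τ`-prime works (KENT + CHEB1); not entangled ⟹ CHEB2. -/
theorem kummerPrimeAtTwo_of_dichotomy (hE : EntangledKummerPrimeLawAtTwo) (hL : LevelPrimesExistAtTwo)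
    (hD : DisentangledKummerPrimeAtTwo) : KummerPrimeAtTwo := by
  intro W _ _ hsurj P hP1 hP2 K
  by_cases hent : KummerEntangledAtTwo W P
  · obtain ⟨ℓ, k, hℓ, ψ, hlev, hKk, hk2, hl, ha, hψ⟩ := hL W hsurj K
    exact ⟨ℓ, k, hℓ, ψ, hlev, hKk, by omega, hl, ha, hψ, hE W hsurj P hP1 hP2 hent ℓ k hlev hk2 hl ha⟩
  · exact hD W hsurj P hP1 hP2 hent K

/-- **ENT-FLAT (candidate, conjecture NEW; corollary of K2-F♯ and KENT): the FLAT first layer of entangled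
curves.**  Setting of `SquareLawAtTwo`; if the `2`-saturated point `P` is entangled then at EVERY `τ`-prime
of level `k ≥ 2` and every `ψ`:  `δ'_k(ℓ;ψ) ∈ 2^{min(k,s+1)} ℤ_{(2)}` and, when `k ≥ s + 2`,
`δ'_k(ℓ;ψ) ∉ 2^{s+2} ℤ_{(2)}` — the valuation is EXACTLY `min(k, s+1)`, with no `d`-spread: every deep
`τ`-prime computes `#Ш[2^∞]`.  BC5 witness: DES13-ENT × DES10/DES11 — the entangled curves of the sample
have `d = 0` on 45/45 level-`≥ 2` rows and `v_obs = min(k, s_an + 1)` on all their level checks.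
Why it might fail: only with `SquareLawAtTwo` (K2-F♯) itself on the entangled sub-class (e.g. a unit of the
finite/singular comparison correlated with `κ(P) = ξ_E`).  Cheapest falsifier: one entangled curve, one
level-`≥ 2` `τ`-prime with `v_obs ≠ min(k, s_an + 1)`. [conjecture] -/
@[conjecture] def FlatFirstLayerOfEntangledAtTwo : Prop :=
  ∀ (W : WeierstrassCurve ℚ) [W.IsElliptic] [W.IsGloballyMinimal] {M : ℕ} [NeZero M]
    (f : CuspForm (Gamma0 M) 2), IsNewformOf W f → PeriodTransferAtTwo W f →
    (∀ n : ℕ, W.HasSurjectiveModNGaloisRep ((2 ^ n : ℕ) : ℤ)) → Odd W.torsionOrder → Odd W.tamagawaProduct →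
    W.rootNumber = -1 → W.mordellWeilRank = 1 → Finite (AddCommGroup.primaryComponent W.sha 2) →
    ∀ P : (W.toAffine.baseChange ℚ).Point, (∀ n : ℕ, n ≠ 0 → n • P ≠ 0) →
      (∀ Q : (W.toAffine.baseChange ℚ).Point, 2 • Q ≠ P) → KummerEntangledAtTwo W P →
    let s := padicValNat 2 (Nat.card (AddCommGroup.primaryComponent W.sha 2))
    ∀ (ℓ k : ℕ) [Fact ℓ.Prime], IsLevelAtTwo W ℓ → 2 ≤ k → (2 ^ k : ℤ) ∣ (ℓ : ℤ) - 1 →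
      (2 ^ k : ℤ) ∣ W.frobeniusTrace ℓ - 2 →
      ∀ ψ : (ZMod ℓ)ˣ →* Multiplicative (ZMod (2 ^ k)), Function.Surjective ψ →
        InTwoPowZLoc (min k (s + 1)) (levelSumTwo f ℓ k ψ) ∧
        (s + 2 ≤ k → ¬ InTwoPowZLoc (s + 2) (levelSumTwo f ℓ k ψ))

/-- **Glue (kernel-checked): K2-F♯ and KENT give the flat first layer of entangled curves.** -/
theorem flatFirstLayer_of_squareLaw (hS : SquareLawAtTwo) (hE : EntangledKummerPrimeLawAtTwo) :
    FlatFirstLayerOfEntangledAtTwo := by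
  intro W _ _ M _ f hf hper hsurj hT hc hw hr hfin P hP1 hP2 hent
  dsimp only
  intro ℓ k _ hlev hk2 hl ha ψ hψ
  have hSW := hS W f hf hper hsurj hT hc hw hr hfin P hP1 hP2 ℓ k 0 hlev (by omega) hl ha ψ hψ
  refine ⟨by simpa using hSW.1 (locallyTwoPowDivisible_zero W ℓ P), fun hsk => ?_⟩
  have hK := hE W hsurj P hP1 hP2 hent ℓ k hlev hk2 hl ha
  simpa using hSW.2 (by simpa using hK) (by simpa using hsk)

/-- **The same two inputs give K2-F (b) on entangled curves at ANY deep `τ`-prime** — the first layer then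
computes `#Ш[2^∞]` on the nose: `2^{s+1} ∥ δ'_k(ℓ;ψ)` for every `τ`-prime of level `k ≥ s + 2`. -/
theorem exact_valuation_of_entangled (hS : SquareLawAtTwo) (hE : EntangledKummerPrimeLawAtTwo)
    (W : WeierstrassCurve ℚ) [W.IsElliptic] [W.IsGloballyMinimal] {M : ℕ} [NeZero M]
    (f : CuspForm (Gamma0 M) 2) (hf : IsNewformOf W f) (hper : PeriodTransferAtTwo W f)
    (hsurj : ∀ n : ℕ, W.HasSurjectiveModNGaloisRep ((2 ^ n : ℕ) : ℤ)) (hT : Odd W.torsionOrder)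
    (hc : Odd W.tamagawaProduct) (hw : W.rootNumber = -1) (hr : W.mordellWeilRank = 1)
    (hfin : Finite (AddCommGroup.primaryComponent W.sha 2))
    (P : (W.toAffine.baseChange ℚ).Point) (hP1 : ∀ n : ℕ, n ≠ 0 → n • P ≠ 0)
    (hP2 : ∀ Q : (W.toAffine.baseChange ℚ).Point, 2 • Q ≠ P) (hent : KummerEntangledAtTwo W P)
    (ℓ k : ℕ) [Fact ℓ.Prime] (hlev : IsLevelAtTwo W ℓ)
    (hk : padicValNat 2 (Nat.card (AddCommGroup.primaryComponent W.sha 2)) + 2 ≤ k)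
    (hl : (2 ^ k : ℤ) ∣ (ℓ : ℤ) - 1) (ha : (2 ^ k : ℤ) ∣ W.frobeniusTrace ℓ - 2)
    (ψ : (ZMod ℓ)ˣ →* Multiplicative (ZMod (2 ^ k))) (hψ : Function.Surjective ψ) :
    InTwoPowZLoc (padicValNat 2 (Nat.card (AddCommGroup.primaryComponent W.sha 2)) + 1) (levelSumTwo f ℓ k ψ) ∧
    ¬ InTwoPowZLoc (padicValNat 2 (Nat.card (AddCommGroup.primaryComponent W.sha 2)) + 2) (levelSumTwo f ℓ k ψ) := by
  have h := flatFirstLayer_of_squareLaw hS hE W f hf hper hsurj hT hc hw hr hfin P hP1 hP2 hent ℓ k hlev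
    (by omega) hl ha ψ hψ
  refine ⟨?_, h.2 hk⟩
  have h1 := h.1
  rwa [min_eq_right (by omega)] at h1

/-- **NEGDISC (candidate support, THEOREM-grade; the archimedean SIGN of the entanglement class):** an
entangled non-`2`-divisible point forces `Δ_E < 0` (one real `2`-torsion point).  Proof: with the roots
`θ₁ < θ₂ < θ₃` of `h`, `loc_∞ ξ_E = sign(−Δ_E h'(θ_i))_i = (−,+,−)`, while `κ_∞(E(ℝ)/2E(ℝ)) = {(+,+,+),(+,−,−)}`;
`κ(P) = ξ_E` is impossible when `Δ_E > 0`.  Data: the two entangled DES curves and the Jones–Rouse example all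
have `Δ < 0`; engine A reports `sign α_E = (−,+,−)` on `Δ > 0` controls (37a1).
Why it might fail: a sign slip in `ξ_E ↔ −Δ_E·h'(θ)` (norm `2^8 Δ_E⁴`, dies in `ℚ(E[4])`: checked).
Cheapest falsifier: one entangled curve with `Δ > 0` in a Cremona scan. [conjecture] -/
@[conjecture] def EntangledNegativeDiscriminantAtTwo : Prop :=
  ∀ (W : WeierstrassCurve ℚ) [W.IsElliptic],
    (∀ n : ℕ, W.HasSurjectiveModNGaloisRep ((2 ^ n : ℕ) : ℤ)) →
    ∀ P : (W.toAffine.baseChange ℚ).Point, (∀ n : ℕ, n ≠ 0 → n • P ≠ 0) →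
      (∀ Q : (W.toAffine.baseChange ℚ).Point, 2 • Q ≠ P) → KummerEntangledAtTwo W P → W.Δ < 0

end Entanglement

end Summit.BirchSwinnertonDyer.Rank1Residual.F1Sign2
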